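import Mathlib.Analysis.InnerProductSpace.PiL2
import Mathlib.Analysis.Calculus.ContDiff.Basic
import Mathlib.Analysis.Calculus.Deriv.Inv
import Mathlib.Analysis.SpecialFunctions.Trigonometric.Deriv
import Mathlib.Analysis.SpecialFunctions.SmoothTransition
import Mathlib.MeasureTheory.Integral.Bochner.Set
import Mathlib.MeasureTheory.Measure.Haar.InnerProductSpace
import HarnessLib

/-!
# Crux `BlockLipschitzL` (stmt-QuantumFields-23533) ∕ `HistoryTailL` (stmt-QuantumFields-19936), LINE 25 «CompactnessTransfer»
# (`Cruxes/HistoryTailL/Lines/compactness_transfer.lean` v1, sha16 a32df1fa) — NEGATIVE-SIDE SUPPORT: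
# the registered stub `stub_uniformSmallScaleEnergy` (S1, F-SU) is FALSE AS TYPED (Bochner vacuity)

Cell `ym3-torus` (YM ladder rung R3 = continuum SU(2) Yang–Mills on T³ — a RUNG, NOT the Clay problem); LEAD seat `ym-ust-19936-w1` gen 9.
THEOREMS ONLY (def-free).  `--supports stmt-QuantumFields-23533`.

S1 quantifies over `C¹` unit maps `U` on the OPEN unit cube of `ℝ³` and measures energies with BOCHNER integrals
`∫ x in cube, Σ_i ‖fderiv ℝ U x eᵢ‖²`.  A `C¹` map on the open cube may have NON-INTEGRABLE energy density (blow-up at the boundary);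
Mathlib's Bochner integral of a non-integrable function is `0` (`MeasureTheory.integral_undef`), so for such a `U` the hypotheses
«energy ≤ Λ» and «`U` minimises among `C¹` unit competitors» hold VACUOUSLY (`0 ≤ Λ`, `0 ≤ ∫ (competitor's density)`), while the
conclusion «`∫_{Q_r} density ≤ ε·r` for all `r ≤ r₁`» is a genuine small-cube statement that an oscillating map violates.
WITNESS (§2–§4): `U_N(x) = cos(φ_N(x₀))•e₀ + sin(φ_N(x₀))•e₁ ∈ S³ ⊂ ℝ⁴`, `φ_N(t) = N·t + χ(4t − 2)·(1 − t)⁻¹`, `χ = Real.smoothTransition`: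
`C¹` on the open cube, unit, density `= N²` on `{|x₀| < 1∕2}` and `= (N + (1 − x₀)⁻²)² ≥ (1 − x₀)⁻⁴` on `{x₀ > 3∕4}` (non-integrable), so
`∫_{Q_r} density = 8N²r³ > ε r` at `r = r₁`, `N = r₁⁻¹`, `ε = Λ = 1`.  §5 ★★`stub_uniformSmallScaleEnergy_false : ¬ S1` (S1 restated VERBATIM).
REPAIR (posted on the cell bus 10:11Z, typed text `S1prime-text.w1g9.lean.txt` 49b989ff): insert
`IntegrableOn (fun x => Σ_i ‖fderiv ℝ U x eᵢ‖²) cube →` after the unit clause (and the same conjunct in S2's conclusion) — then S1′ is the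
Schoen–Uhlenbeck 1982∕84 + Luckhaus 1988 reading the line intends.  This file refutes the TYPED v1 text only; it says nothing against S1′ or the line.
-/

set_option autoImplicit false

noncomputable section

open scoped BigOperators
open MeasureTheory Set

namespace Summit.QuantumFields.YangMills.Theorems.BlockLipschitzL.Negative

/-! ## §1 Letters: a norm in `ℝ⁴`, coordinate boxes in `ℝ³` and their volume -/

/-- `‖a•e₀ + b•e₁‖² = a² + b²` in `EuclideanSpace ℝ (Fin 4)`. [folklore] -/
theorem norm_sq_pair (a b : ℝ) :
    ‖(a • EuclideanSpace.single (0 : Fin 4) (1 : ℝ) + b • EuclideanSpace.single (1 : Fin 4) (1 : ℝ) :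
      EuclideanSpace ℝ (Fin 4))‖ ^ 2 = a ^ 2 + b ^ 2 := by
  rw [EuclideanSpace.norm_eq, Real.sq_sqrt (by positivity)]
  simp [Fin.sum_univ_four]

/-- `‖a•e₀ + b•e₁‖ = 1` when `a = cos θ`, `b = sin θ`. [folklore] -/
theorem norm_cos_sin (θ : ℝ) :
    ‖(Real.cos θ • EuclideanSpace.single (0 : Fin 4) (1 : ℝ) + Real.sin θ • EuclideanSpace.single (1 : Fin 4) (1 : ℝ) :
      EuclideanSpace ℝ (Fin 4))‖ = 1 := by
  have h := norm_sq_pair (Real.cos θ) (Real.sin θ)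
  rw [Real.cos_sq_add_sin_sq] at h
  have h0 : 0 ≤ ‖(Real.cos θ • EuclideanSpace.single (0 : Fin 4) (1 : ℝ) +
      Real.sin θ • EuclideanSpace.single (1 : Fin 4) (1 : ℝ) : EuclideanSpace ℝ (Fin 4))‖ := norm_nonneg _
  nlinarith

/-- The coordinate box `{a i < x i < b i}` of `EuclideanSpace ℝ (Fin 3)` is the preimage of the product of intervals under `ofLp`. -/
theorem coordBox_eq_preimage (a b : Fin 3 → ℝ) :
    {x : EuclideanSpace ℝ (Fin 3) | ∀ i, a i < x i ∧ x i < b i} =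
      (WithLp.ofLp : EuclideanSpace ℝ (Fin 3) → (Fin 3 → ℝ)) ⁻¹' (Set.pi univ fun i => Ioo (a i) (b i)) := by
  ext x
  simp [Set.mem_pi]

/-- Coordinate boxes are measurable. [folklore] -/
theorem measurableSet_coordBox (a b : Fin 3 → ℝ) :
    MeasurableSet {x : EuclideanSpace ℝ (Fin 3) | ∀ i, a i < x i ∧ x i < b i} := by
  rw [coordBox_eq_preimage]
  exact (MeasurableSet.univ_pi fun i => measurableSet_Ioo).preimage (PiLp.volume_preserving_ofLp (Fin 3)).measurable

/-- Lebesgue volume of a coordinate box: `∏ (b i − a i)`. [folklore] -/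
theorem volume_coordBox (a b : Fin 3 → ℝ) :
    volume {x : EuclideanSpace ℝ (Fin 3) | ∀ i, a i < x i ∧ x i < b i} = ∏ i, ENNReal.ofReal (b i - a i) := by
  rw [coordBox_eq_preimage, (PiLp.volume_preserving_ofLp (Fin 3)).measure_preimage
    (MeasurableSet.univ_pi fun i => measurableSet_Ioo).nullMeasurableSet, Real.volume_pi_Ioo]

/-- The sup-norm cube `{|x i| < r}` is the coordinate box `(−r, r)³`. -/
theorem absCube_eq_coordBox (r : ℝ) :
    {x : EuclideanSpace ℝ (Fin 3) | ∀ i : Fin 3, |x i| < r} =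
      {x : EuclideanSpace ℝ (Fin 3) | ∀ i, (fun _ : Fin 3 => -r) i < x i ∧ x i < (fun _ : Fin 3 => r) i} := by
  ext x
  simp only [Set.mem_setOf_eq, abs_lt]

/-- Volume of the sup-norm cube of half-side `r ≥ 0`: `(2r)³` (as a real number). [folklore] -/
theorem volume_real_absCube {r : ℝ} (hr : 0 ≤ r) :
    (volume {x : EuclideanSpace ℝ (Fin 3) | ∀ i : Fin 3, |x i| < r}).toReal = (2 * r) ^ 3 := by
  rw [absCube_eq_coordBox, volume_coordBox]
  simp only [sub_neg_eq_add, Finset.prod_const, Finset.card_univ, Fintype.card_fin]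
  rw [ENNReal.toReal_pow, ENNReal.toReal_ofReal (by linarith)]
  ring

/-! ## §2 The witness: profile `φ_N(t) = N t + χ(4t−2)(1−t)⁻¹`, map `U(x) = cos(φ(x₀))•e₀ + sin(φ(x₀))•e₁` -/

/-- On `t < 1∕2` the profile is linear near `t`, hence `φ_N′(t) = N`. [folklore] -/
theorem hasDerivAt_profile_low (N : ℝ) {t : ℝ} (ht : t < 1 / 2) :
    HasDerivAt (fun s : ℝ => N * s + Real.smoothTransition (4 * s - 2) * (1 - s)⁻¹) N t := by
  have hev : (fun s : ℝ => N * s) =ᶠ[nhds t] (fun s : ℝ => N * s + Real.smoothTransition (4 * s - 2) * (1 - s)⁻¹) := by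
    have hopen : IsOpen {s : ℝ | s < 1 / 2} := isOpen_gt' _
    filter_upwards [hopen.mem_nhds ht] with s hs
    have hs0 : s < 1 / 2 := hs
    have hs' : (4 : ℝ) * s - 2 ≤ 0 := by linarith
    rw [Real.smoothTransition.zero_of_nonpos hs', zero_mul, add_zero]
  have hlin : HasDerivAt (fun s : ℝ => N * s) N t := by
    have h := (hasDerivAt_id t).const_mul N
    simp only [mul_one] at h
    exact h
  exact hlin.congr_of_eventuallyEq hev.symm

/-- On `3∕4 < t < 1` the profile is `N·t + (1−t)⁻¹` near `t`, hence `φ_N′(t) = N + ((1−t)²)⁻¹`. [folklore] -/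
theorem hasDerivAt_profile_high (N : ℝ) {t : ℝ} (ht : 3 / 4 < t) (ht1 : t < 1) :
    HasDerivAt (fun s : ℝ => N * s + Real.smoothTransition (4 * s - 2) * (1 - s)⁻¹) (N + ((1 - t) ^ 2)⁻¹) t := by
  have hev : (fun s : ℝ => N * s + (1 - s)⁻¹) =ᶠ[nhds t] (fun s : ℝ => N * s + Real.smoothTransition (4 * s - 2) * (1 - s)⁻¹) := by
    have hopen : IsOpen {s : ℝ | 3 / 4 < s} := isOpen_lt' _
    filter_upwards [hopen.mem_nhds ht] with s hs
    have hs0 : 3 / 4 < s := hs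
    have hs' : (1 : ℝ) ≤ 4 * s - 2 := by linarith
    rw [Real.smoothTransition.one_of_one_le hs', one_mul]
  have h1 : HasDerivAt (fun s : ℝ => N * s) N t := by
    have h := (hasDerivAt_id t).const_mul N
    simp only [mul_one] at h
    exact h
  have hne : (1 : ℝ) - t ≠ 0 := sub_ne_zero.2 (ne_of_gt ht1)
  have h2 : HasDerivAt (fun s : ℝ => (1 - s)⁻¹) (((1 - t) ^ 2)⁻¹) t := by
    have h := ((hasDerivAt_id t).const_sub 1).inv hne
    have hval : -(-(1 : ℝ)) / (1 - id t) ^ 2 = ((1 - t) ^ 2)⁻¹ := by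
      simp only [id, neg_neg, one_div]
    rw [hval] at h
    exact h
  exact (h1.add h2).congr_of_eventuallyEq hev.symm

/-- The profile is `C¹` on `{t < 1}`. [folklore] -/
theorem contDiffOn_profile (N : ℝ) :
    ContDiffOn ℝ 1 (fun s : ℝ => N * s + Real.smoothTransition (4 * s - 2) * (1 - s)⁻¹) {s : ℝ | s < 1} := by
  apply ContDiffOn.add
  · exact (contDiff_const.mul contDiff_id).contDiffOn
  · apply ContDiffOn.mul
    · exact ((Real.smoothTransition.contDiff (n := 1)).comp
        ((contDiff_const.mul contDiff_id).sub contDiff_const)).contDiffOn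
    · exact (contDiffOn_const.sub contDiffOn_id).inv (fun s hs => by
        have hs1 : s < 1 := hs
        exact sub_ne_zero.2 (ne_of_gt hs1))

/-- A map `x ↦ cos(φ(x₀))•e₀ + sin(φ(x₀))•e₁` is unit-valued. [folklore] -/
theorem norm_witness (φ : ℝ → ℝ) (U : EuclideanSpace ℝ (Fin 3) → EuclideanSpace ℝ (Fin 4))
    (hU : U = fun x => Real.cos (φ (x 0)) • EuclideanSpace.single (0 : Fin 4) (1 : ℝ) + Real.sin (φ (x 0)) • EuclideanSpace.single (1 : Fin 4) (1 : ℝ)) (x : EuclideanSpace ℝ (Fin 3)) :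
    ‖U x‖ = 1 := by
  subst hU
  exact norm_cos_sin _

/-- A map `x ↦ cos(φ(x₀))•e₀ + sin(φ(x₀))•e₁` with `φ ∈ C¹({t < 1})` is `C¹` on the open unit cube. [folklore] -/
theorem contDiffOn_witness (φ : ℝ → ℝ) (hφ : ContDiffOn ℝ 1 φ {s : ℝ | s < 1}) (U : EuclideanSpace ℝ (Fin 3) → EuclideanSpace ℝ (Fin 4))
    (hU : U = fun x => Real.cos (φ (x 0)) • EuclideanSpace.single (0 : Fin 4) (1 : ℝ) + Real.sin (φ (x 0)) • EuclideanSpace.single (1 : Fin 4) (1 : ℝ)) :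
    ContDiffOn ℝ 1 U {x : EuclideanSpace ℝ (Fin 3) | ∀ i : Fin 3, |x i| < 1} := by
  subst hU
  have hπ : ContDiff ℝ 1 (fun x : EuclideanSpace ℝ (Fin 3) => x 0) :=
    (EuclideanSpace.proj (0 : Fin 3) : EuclideanSpace ℝ (Fin 3) →L[ℝ] ℝ).contDiff
  have hmaps : Set.MapsTo (fun x : EuclideanSpace ℝ (Fin 3) => x 0) {x : EuclideanSpace ℝ (Fin 3) | ∀ i : Fin 3, |x i| < 1} {s : ℝ | s < 1} := by
    intro x hx
    exact (abs_lt.1 (hx 0)).2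
  have hφx : ContDiffOn ℝ 1 (fun x : EuclideanSpace ℝ (Fin 3) => φ (x 0)) {x | ∀ i : Fin 3, |x i| < 1} := hφ.comp hπ.contDiffOn hmaps
  exact ((Real.contDiff_cos.comp_contDiffOn hφx).smul contDiffOn_const).add
    ((Real.contDiff_sin.comp_contDiffOn hφx).smul contDiffOn_const)

/-- Evaluation of the chain-rule derivative `v ↦ (v 0)•w` on the coordinate vectors. [folklore] -/
theorem toSpanSingleton_comp_proj_single (w : EuclideanSpace ℝ (Fin 4)) (i : Fin 3) :
    ((ContinuousLinearMap.toSpanSingleton ℝ w).comp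
      (EuclideanSpace.proj (0 : Fin 3) : EuclideanSpace ℝ (Fin 3) →L[ℝ] ℝ)) (EuclideanSpace.single i (1 : ℝ)) =
      (if i = 0 then (1 : ℝ) else 0) • w := by
  have hproj : (EuclideanSpace.proj (0 : Fin 3) : EuclideanSpace ℝ (Fin 3) →L[ℝ] ℝ) (EuclideanSpace.single i (1 : ℝ)) =
      if i = 0 then (1 : ℝ) else 0 := by
    show (EuclideanSpace.single i (1 : ℝ) : EuclideanSpace ℝ (Fin 3)) 0 = _
    by_cases h : i = 0
    · subst h; simp
    · simp [h, Ne.symm h]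
  rw [ContinuousLinearMap.comp_apply, ContinuousLinearMap.toSpanSingleton_apply, hproj]

/-- The energy density of `U = cos(φ(x₀))•e₀ + sin(φ(x₀))•e₁` at a point where `φ′(x₀) = d`: `Σ_i ‖fderiv U x eᵢ‖² = d²`. [folklore] -/
theorem density_eq_of_hasDerivAt (φ : ℝ → ℝ) (U : EuclideanSpace ℝ (Fin 3) → EuclideanSpace ℝ (Fin 4))
    (hU : U = fun x => Real.cos (φ (x 0)) • EuclideanSpace.single (0 : Fin 4) (1 : ℝ) + Real.sin (φ (x 0)) • EuclideanSpace.single (1 : Fin 4) (1 : ℝ))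
    {x : EuclideanSpace ℝ (Fin 3)} {d : ℝ} (hd : HasDerivAt φ d (x 0)) :
    ∑ i : Fin 3, ‖fderiv ℝ U x (EuclideanSpace.single i (1 : ℝ))‖ ^ 2 = d ^ 2 := by
  subst hU
  have hg : HasDerivAt (fun s : ℝ => Real.cos (φ s) • EuclideanSpace.single (0 : Fin 4) (1 : ℝ) + Real.sin (φ s) • EuclideanSpace.single (1 : Fin 4) (1 : ℝ))
      ((-Real.sin (φ (x 0)) * d) • EuclideanSpace.single (0 : Fin 4) (1 : ℝ) + (Real.cos (φ (x 0)) * d) • EuclideanSpace.single (1 : Fin 4) (1 : ℝ)) (x 0) :=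
    (((Real.hasDerivAt_cos _).comp (x 0) hd).smul_const _).add (((Real.hasDerivAt_sin _).comp (x 0) hd).smul_const _)
  have hπ : HasFDerivAt (fun y : EuclideanSpace ℝ (Fin 3) => y 0) (EuclideanSpace.proj (0 : Fin 3) : EuclideanSpace ℝ (Fin 3) →L[ℝ] ℝ) x :=
    (EuclideanSpace.proj (0 : Fin 3) : EuclideanSpace ℝ (Fin 3) →L[ℝ] ℝ).hasFDerivAt
  have hcomp := hg.hasFDerivAt.comp x hπ
  simp only [Function.comp_def] at hcomp
  rw [hcomp.fderiv, Fin.sum_univ_three, toSpanSingleton_comp_proj_single, toSpanSingleton_comp_proj_single,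
    toSpanSingleton_comp_proj_single, if_pos rfl, if_neg (by decide), if_neg (by decide), one_smul, zero_smul,
    norm_zero, norm_sq_pair]
  have hsc := Real.sin_sq_add_cos_sq (φ (x 0))
  have : (0 : ℝ) ^ 2 = 0 := by norm_num
  rw [this, add_zero, add_zero]
  linear_combination d ^ 2 * hsc

/-! ## §3 The density of the witness: `N²` on `{x₀ < 1∕2}`, `(N + (1−x₀)⁻²)²` on `{3∕4 < x₀ < 1}` -/

/-- Density `= N²` where `x₀ < 1∕2`. -/
theorem density_low (N : ℝ) (U : EuclideanSpace ℝ (Fin 3) → EuclideanSpace ℝ (Fin 4))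
    (hU : U = fun x => Real.cos ((fun s : ℝ => N * s + Real.smoothTransition (4 * s - 2) * (1 - s)⁻¹) (x 0)) • EuclideanSpace.single (0 : Fin 4) (1 : ℝ) + Real.sin ((fun s : ℝ => N * s + Real.smoothTransition (4 * s - 2) * (1 - s)⁻¹) (x 0)) • EuclideanSpace.single (1 : Fin 4) (1 : ℝ))
    {x : EuclideanSpace ℝ (Fin 3)} (hx : x 0 < 1 / 2) :
    ∑ i : Fin 3, ‖fderiv ℝ U x (EuclideanSpace.single i (1 : ℝ))‖ ^ 2 = N ^ 2 :=
  density_eq_of_hasDerivAt (fun s : ℝ => N * s + Real.smoothTransition (4 * s - 2) * (1 - s)⁻¹) U hU (hasDerivAt_profile_low N hx)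

/-- Density `= (N + ((1−x₀)²)⁻¹)²` where `3∕4 < x₀ < 1`. -/
theorem density_high (N : ℝ) (U : EuclideanSpace ℝ (Fin 3) → EuclideanSpace ℝ (Fin 4))
    (hU : U = fun x => Real.cos ((fun s : ℝ => N * s + Real.smoothTransition (4 * s - 2) * (1 - s)⁻¹) (x 0)) • EuclideanSpace.single (0 : Fin 4) (1 : ℝ) + Real.sin ((fun s : ℝ => N * s + Real.smoothTransition (4 * s - 2) * (1 - s)⁻¹) (x 0)) • EuclideanSpace.single (1 : Fin 4) (1 : ℝ))
    {x : EuclideanSpace ℝ (Fin 3)} (hx : 3 / 4 < x 0) (hx1 : x 0 < 1) :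
    ∑ i : Fin 3, ‖fderiv ℝ U x (EuclideanSpace.single i (1 : ℝ))‖ ^ 2 = (N + ((1 - x 0) ^ 2)⁻¹) ^ 2 :=
  density_eq_of_hasDerivAt (fun s : ℝ => N * s + Real.smoothTransition (4 * s - 2) * (1 - s)⁻¹) U hU (hasDerivAt_profile_high N hx hx1)

/-- The energy on a small concentric cube `Q_r`, `0 ≤ r ≤ 1∕8`: `∫_{Q_r} density = (2r)³·N²`. -/
theorem integral_density_smallCube (N : ℝ) (U : EuclideanSpace ℝ (Fin 3) → EuclideanSpace ℝ (Fin 4))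
    (hU : U = fun x => Real.cos ((fun s : ℝ => N * s + Real.smoothTransition (4 * s - 2) * (1 - s)⁻¹) (x 0)) • EuclideanSpace.single (0 : Fin 4) (1 : ℝ) + Real.sin ((fun s : ℝ => N * s + Real.smoothTransition (4 * s - 2) * (1 - s)⁻¹) (x 0)) • EuclideanSpace.single (1 : Fin 4) (1 : ℝ))
    {r : ℝ} (hr0 : 0 ≤ r) (hr : r ≤ 1 / 8) :
    ∫ x in {x : EuclideanSpace ℝ (Fin 3) | ∀ i : Fin 3, |x i| < r}, ∑ i : Fin 3, ‖fderiv ℝ U x (EuclideanSpace.single i (1 : ℝ))‖ ^ 2 = (2 * r) ^ 3 * N ^ 2 := by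
  have hmeas : MeasurableSet {x : EuclideanSpace ℝ (Fin 3) | ∀ i : Fin 3, |x i| < r} := by
    rw [absCube_eq_coordBox]; exact measurableSet_coordBox _ _
  have hcongr : ∫ x in {x : EuclideanSpace ℝ (Fin 3) | ∀ i : Fin 3, |x i| < r}, ∑ i : Fin 3, ‖fderiv ℝ U x (EuclideanSpace.single i (1 : ℝ))‖ ^ 2 =
      ∫ x in {x : EuclideanSpace ℝ (Fin 3) | ∀ i : Fin 3, |x i| < r}, N ^ 2 := by
    refine setIntegral_congr_fun hmeas (fun x hx => ?_)
    have hx0 : x 0 < 1 / 2 := by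
      have := (abs_lt.1 (hx 0)).2
      linarith
    exact density_low N U hU hx0
  rw [hcongr, setIntegral_const, smul_eq_mul, measureReal_def, volume_real_absCube hr0]

/-! ## §4 The density of the witness is NOT integrable on the open unit cube -/

/-- The boundary slab `{1 − 2η < x₀ < 1 − η, |x₁| < 1, |x₂| < 1}` has volume `4η` and lies in the open unit cube. -/
theorem volume_real_slab {η : ℝ} (hη : 0 < η) :
    (volume {x : EuclideanSpace ℝ (Fin 3) | ∀ i, (![1 - 2 * η, -1, -1] : Fin 3 → ℝ) i < x i ∧
      x i < (![1 - η, 1, 1] : Fin 3 → ℝ) i}).toReal = 4 * η := by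
  rw [volume_coordBox, Fin.prod_univ_three]
  simp only [Matrix.cons_val_zero, Matrix.cons_val_one, Matrix.cons_val_two, Matrix.head_cons, Matrix.tail_cons]
  rw [ENNReal.toReal_mul, ENNReal.toReal_mul, ENNReal.toReal_ofReal (by linarith), ENNReal.toReal_ofReal (by norm_num)]
  ring

/-- ★ NON-INTEGRABILITY: for `N ≥ 0` the witness' energy density is not integrable on the open unit cube
(it is `≥ (1 − x₀)⁻⁴` on `{x₀ > 3∕4}`). [folklore] -/
theorem not_integrableOn_density (N : ℝ) (hN : 0 ≤ N) (U : EuclideanSpace ℝ (Fin 3) → EuclideanSpace ℝ (Fin 4))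
    (hU : U = fun x => Real.cos ((fun s : ℝ => N * s + Real.smoothTransition (4 * s - 2) * (1 - s)⁻¹) (x 0)) • EuclideanSpace.single (0 : Fin 4) (1 : ℝ) + Real.sin ((fun s : ℝ => N * s + Real.smoothTransition (4 * s - 2) * (1 - s)⁻¹) (x 0)) • EuclideanSpace.single (1 : Fin 4) (1 : ℝ)) :
    ¬ IntegrableOn (fun x : EuclideanSpace ℝ (Fin 3) => ∑ i : Fin 3, ‖fderiv ℝ U x (EuclideanSpace.single i (1 : ℝ))‖ ^ 2) {x : EuclideanSpace ℝ (Fin 3) | ∀ i : Fin 3, |x i| < 1} := by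
  intro hint
  obtain ⟨n, hn⟩ := exists_nat_gt (∫ x in {x : EuclideanSpace ℝ (Fin 3) | ∀ i : Fin 3, |x i| < 1}, ∑ i : Fin 3, ‖fderiv ℝ U x (EuclideanSpace.single i (1 : ℝ))‖ ^ 2)
  -- the slab at depth `η = 1/(8(n+1))`
  obtain ⟨η, hη⟩ : ∃ η : ℝ, η = 1 / (8 * ((n : ℝ) + 1)) := ⟨_, rfl⟩
  have hn1 : (1 : ℝ) ≤ (n : ℝ) + 1 := by
    have : (0 : ℝ) ≤ n := Nat.cast_nonneg n
    linarith
  have hηpos : 0 < η := by rw [hη]; positivity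
  have hη8 : η ≤ 1 / 8 := by
    rw [hη, div_le_div_iff₀ (by positivity) (by norm_num)]
    linarith
  obtain ⟨S, hS⟩ : ∃ S : Set (EuclideanSpace ℝ (Fin 3)), S = {x : EuclideanSpace ℝ (Fin 3) | ∀ i, (![1 - 2 * η, -1, -1] : Fin 3 → ℝ) i < x i ∧
      x i < (![1 - η, 1, 1] : Fin 3 → ℝ) i} := ⟨_, rfl⟩
  have hSmeas : MeasurableSet S := by rw [hS]; exact measurableSet_coordBox _ _
  have ha : ∀ i : Fin 3, (-1 : ℝ) ≤ (![1 - 2 * η, -1, -1] : Fin 3 → ℝ) i := by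
    intro i
    fin_cases i <;> simp
    linarith
  have hb : ∀ i : Fin 3, (![1 - η, 1, 1] : Fin 3 → ℝ) i ≤ 1 := by
    intro i
    fin_cases i <;> simp
    linarith
  have hSsub : S ⊆ {x : EuclideanSpace ℝ (Fin 3) | ∀ i : Fin 3, |x i| < 1} := by
    intro x hx
    rw [hS] at hx
    intro i
    have hxi := hx i
    rw [abs_lt]
    exact ⟨by linarith [ha i, hxi.1], by linarith [hb i, hxi.2]⟩
  have hSvol : (volume S).toReal = 4 * η := by rw [hS]; exact volume_real_slab hηpos
  have hSfin : volume S ≠ ⊤ := by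
    intro htop
    rw [htop, ENNReal.toReal_top] at hSvol
    linarith
  -- lower bound of the density on the slab
  have hlow : ∀ x ∈ S, ((2 * η) ^ 2)⁻¹ ^ 2 ≤ ∑ i : Fin 3, ‖fderiv ℝ U x (EuclideanSpace.single i (1 : ℝ))‖ ^ 2 := by
    intro x hx
    rw [hS] at hx
    have hx0 := hx 0
    simp only [Matrix.cons_val_zero] at hx0
    have hgt : 3 / 4 < x 0 := by linarith
    have hlt : x 0 < 1 := by linarith
    rw [density_high N U hU hgt hlt]
    have hpos : 0 < (1 - x 0) ^ 2 := by
      have : 0 < 1 - x 0 := by linarith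
      positivity
    have hsq : (1 - x 0) ^ 2 ≤ (2 * η) ^ 2 := by
      have h1 : 0 ≤ 1 - x 0 := by linarith
      have h2 : 1 - x 0 ≤ 2 * η := by linarith
      exact pow_le_pow_left₀ h1 h2 2
    have hinv : ((2 * η) ^ 2)⁻¹ ≤ ((1 - x 0) ^ 2)⁻¹ := by
      rw [inv_le_inv₀ (by positivity) hpos]; exact hsq
    have hA0 : 0 ≤ ((2 * η) ^ 2)⁻¹ := by positivity
    have hB : ((2 * η) ^ 2)⁻¹ ≤ N + ((1 - x 0) ^ 2)⁻¹ := by linarith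
    exact pow_le_pow_left₀ hA0 hB 2
  -- integrate: `vol(S)·(2η)⁻⁴ ≤ ∫_S ≤ ∫_cube < n`, while `vol(S)·(2η)⁻⁴ = 1/(4η³) = 128(n+1)³ ≥ n`
  have hintS : IntegrableOn (fun x : EuclideanSpace ℝ (Fin 3) => ∑ i : Fin 3, ‖fderiv ℝ U x (EuclideanSpace.single i (1 : ℝ))‖ ^ 2) S := hint.mono_set hSsub
  have h1 : (volume S).toReal * ((2 * η) ^ 2)⁻¹ ^ 2 ≤ ∫ x in S, ∑ i : Fin 3, ‖fderiv ℝ U x (EuclideanSpace.single i (1 : ℝ))‖ ^ 2 := by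
    have h := setIntegral_mono_on (integrableOn_const hSfin) hintS hSmeas hlow
    rwa [setIntegral_const, smul_eq_mul, measureReal_def] at h
  have h2 : ∫ x in S, ∑ i : Fin 3, ‖fderiv ℝ U x (EuclideanSpace.single i (1 : ℝ))‖ ^ 2 ≤ ∫ x in {x : EuclideanSpace ℝ (Fin 3) | ∀ i : Fin 3, |x i| < 1}, ∑ i : Fin 3, ‖fderiv ℝ U x (EuclideanSpace.single i (1 : ℝ))‖ ^ 2 :=
    setIntegral_mono_set hint (Filter.Eventually.of_forall fun x => by positivity) hSsub.eventuallyLE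
  have h3 : (volume S).toReal * ((2 * η) ^ 2)⁻¹ ^ 2 = 1 / (4 * η ^ 3) := by
    rw [hSvol]
    field_simp
    ring
  have h4 : 1 / (4 * η ^ 3) = 128 * ((n : ℝ) + 1) ^ 3 := by
    rw [hη]
    field_simp
    ring
  have h5 : (n : ℝ) + 1 ≤ ((n : ℝ) + 1) ^ 3 := le_self_pow₀ hn1 (by norm_num)
  have h6 : (n : ℝ) < ∫ x in S, ∑ i : Fin 3, ‖fderiv ℝ U x (EuclideanSpace.single i (1 : ℝ))‖ ^ 2 := by
    rw [h3, h4] at h1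
    nlinarith [h1, h5]
  exact absurd (h6.trans_le h2) (not_lt.2 hn.le)

/-! ## §5 The refutation of S1 as typed -/

/-- ★★ `stub_uniformSmallScaleEnergy` of LINE 25 `compactness_transfer.lean` (v1, a32df1fa) — restated VERBATIM — is FALSE: at `Λ = ε = 1` the
witness `U_N`, `N = r₁⁻¹`, satisfies every hypothesis VACUOUSLY (its energy density is not integrable on the open cube, so both Bochner
integrals of it over the cube are `0`) while `∫_{Q_{r₁}} density = 8N²r₁³ = 8r₁ > 1·r₁`.  The intended statement needs the hypothesis
`IntegrableOn (density of U) cube` (S1′). [folklore] -/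
theorem stub_uniformSmallScaleEnergy_false : ¬ (
      ∀ (Λ ε : ℝ), 0 < Λ → 0 < ε → ∃ r₁ : ℝ, 0 < r₁ ∧ r₁ ≤ 1 / 8 ∧
        ∀ (U : EuclideanSpace ℝ (Fin 3) → EuclideanSpace ℝ (Fin 4)), ContDiffOn ℝ 1 U {x : EuclideanSpace ℝ (Fin 3) | ∀ i : Fin 3, |x i| < 1} →
        (∀ x : EuclideanSpace ℝ (Fin 3), (∀ i : Fin 3, |x i| < 1) → ‖U x‖ = 1) →
        (∀ (V : EuclideanSpace ℝ (Fin 3) → EuclideanSpace ℝ (Fin 4)) (s : ℝ), s < 1 → ContDiffOn ℝ 1 V {x : EuclideanSpace ℝ (Fin 3) | ∀ i : Fin 3, |x i| < 1} →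
          (∀ x : EuclideanSpace ℝ (Fin 3), (∀ i : Fin 3, |x i| < 1) → ‖V x‖ = 1) →
          (∀ x : EuclideanSpace ℝ (Fin 3), (∃ i : Fin 3, s ≤ |x i|) → V x = U x) →
          ∫ x in {x : EuclideanSpace ℝ (Fin 3) | ∀ i : Fin 3, |x i| < 1}, ∑ i : Fin 3, ‖fderiv ℝ U x (EuclideanSpace.single i (1:ℝ))‖ ^ 2 ≤
            ∫ x in {x : EuclideanSpace ℝ (Fin 3) | ∀ i : Fin 3, |x i| < 1}, ∑ i : Fin 3, ‖fderiv ℝ V x (EuclideanSpace.single i (1:ℝ))‖ ^ 2) →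
        ∫ x in {x : EuclideanSpace ℝ (Fin 3) | ∀ i : Fin 3, |x i| < 1}, ∑ i : Fin 3, ‖fderiv ℝ U x (EuclideanSpace.single i (1:ℝ))‖ ^ 2 ≤ Λ →
        ∀ r : ℝ, 0 < r → r ≤ r₁ →
          ∫ x in {x : EuclideanSpace ℝ (Fin 3) | ∀ i : Fin 3, |x i| < r}, ∑ i : Fin 3, ‖fderiv ℝ U x (EuclideanSpace.single i (1:ℝ))‖ ^ 2 ≤ ε * r ) := by
  intro h
  obtain ⟨r₁, hr₁, hr₁8, H⟩ := h 1 1 one_pos one_pos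
  obtain ⟨N, hN⟩ : ∃ N : ℝ, N = r₁⁻¹ := ⟨_, rfl⟩
  have hN0 : 0 ≤ N := by rw [hN]; positivity
  obtain ⟨U, hU⟩ : ∃ U : EuclideanSpace ℝ (Fin 3) → EuclideanSpace ℝ (Fin 4),
      U = fun x => Real.cos ((fun s : ℝ => N * s + Real.smoothTransition (4 * s - 2) * (1 - s)⁻¹) (x 0)) • EuclideanSpace.single (0 : Fin 4) (1 : ℝ) + Real.sin ((fun s : ℝ => N * s + Real.smoothTransition (4 * s - 2) * (1 - s)⁻¹) (x 0)) • EuclideanSpace.single (1 : Fin 4) (1 : ℝ) := ⟨_, rfl⟩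
  have hC : ContDiffOn ℝ 1 U {x : EuclideanSpace ℝ (Fin 3) | ∀ i : Fin 3, |x i| < 1} :=
    contDiffOn_witness (fun s : ℝ => N * s + Real.smoothTransition (4 * s - 2) * (1 - s)⁻¹) (contDiffOn_profile N) U hU
  have hunit : ∀ x : EuclideanSpace ℝ (Fin 3), (∀ i : Fin 3, |x i| < 1) → ‖U x‖ = 1 := fun x _ => norm_witness (fun s : ℝ => N * s + Real.smoothTransition (4 * s - 2) * (1 - s)⁻¹) U hU x
  have h0 : ∫ x in {x : EuclideanSpace ℝ (Fin 3) | ∀ i : Fin 3, |x i| < 1}, ∑ i : Fin 3, ‖fderiv ℝ U x (EuclideanSpace.single i (1 : ℝ))‖ ^ 2 = 0 :=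
    integral_undef (not_integrableOn_density N hN0 U hU)
  have hmin : ∀ (V : EuclideanSpace ℝ (Fin 3) → EuclideanSpace ℝ (Fin 4)) (s : ℝ), s < 1 → ContDiffOn ℝ 1 V {x : EuclideanSpace ℝ (Fin 3) | ∀ i : Fin 3, |x i| < 1} →
      (∀ x : EuclideanSpace ℝ (Fin 3), (∀ i : Fin 3, |x i| < 1) → ‖V x‖ = 1) →
      (∀ x : EuclideanSpace ℝ (Fin 3), (∃ i : Fin 3, s ≤ |x i|) → V x = U x) →
      ∫ x in {x : EuclideanSpace ℝ (Fin 3) | ∀ i : Fin 3, |x i| < 1}, ∑ i : Fin 3, ‖fderiv ℝ U x (EuclideanSpace.single i (1 : ℝ))‖ ^ 2 ≤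
        ∫ x in {x : EuclideanSpace ℝ (Fin 3) | ∀ i : Fin 3, |x i| < 1}, ∑ i : Fin 3, ‖fderiv ℝ V x (EuclideanSpace.single i (1 : ℝ))‖ ^ 2 := by
    intro V s _ _ _ _
    rw [h0]
    exact integral_nonneg fun x => by positivity
  have hΛ : ∫ x in {x : EuclideanSpace ℝ (Fin 3) | ∀ i : Fin 3, |x i| < 1}, ∑ i : Fin 3, ‖fderiv ℝ U x (EuclideanSpace.single i (1 : ℝ))‖ ^ 2 ≤ 1 := by rw [h0]; norm_num
  have hconcl := H U hC hunit hmin hΛ r₁ hr₁ le_rfl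
  have hval := integral_density_smallCube N U hU hr₁.le hr₁8
  -- `(2r₁)³ · r₁⁻² = 8 r₁ ≤ 1 · r₁` is false
  have hr0 : r₁ ≠ 0 := ne_of_gt hr₁
  have h8 : (2 * r₁) ^ 3 * N ^ 2 = 8 * r₁ := by
    rw [hN]
    field_simp
    norm_num
  have hbad : 8 * r₁ ≤ 1 * r₁ := by
    rw [← h8, ← hval]
    exact hconcl
  linarith

end Summit.QuantumFields.YangMills.Theorems.BlockLipschitzL.Negative

end
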